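import Summits.Schanuel.Schanuel.Theorems.ZilberEacLogStrip
import Literature.ModelTheory.Zilber.EACDensityQuestion
import HarnessLib

/-!
# Density from growth: escaping exponential points are Zariski generic on surfaces

Zilber's Exponential-Algebraic Closedness, case ladder (host summit Schanuel, cell `pub-schanuel`,
seat 2, gen 5).  A general mechanism for Mantova–Masser's density question (PLMS 2024, §1
"Further remarks"): on an irreducible SURFACE, any sequence of points whose `j₀`-th coordinate pair
is exponential, `y_{j₀} = e^{x_{j₀}}`, and ESCAPES, `|Re x_{j₀}| / log (2 + ‖x_{j₀}‖) → ∞`, is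
Zariski generic.

**Theorem G** (`finite_zeros_of_growth`).  Let `S ⊆ ℂⁿ × ℂⁿ` be irreducible closed with
`dim S ≤ 2`, `j₀ : Fin n`, and `p₀, p₁, … ∈ S` with `(p_m)_{y_{j₀}} = e^{(p_m)_{x_{j₀}}}` and
`|Re (p_m)_{x_{j₀}}| / log(2 + ‖(p_m)_{x_{j₀}}‖) → ∞`.  Then every polynomial `f ∉ I(S)` vanishes at
only finitely many `p_m`.  **Corollary** (`unprojectedDense_of_growth`): if the `p_m` are exponential
points, `S` has Zariski-dense exponential points (`UnprojectedDense S`).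

Proof.  If `f ∉ I(S)` killed infinitely many `p_m`, Noetherian induction gives an infinite
subsequence `M` whose vanishing ideal `J ⊋ I(S)` is maximal among such, hence PRIME and stable under
passing to infinite subsequences; `dim ℂ[X]/J ≤ 1` (a proper prime quotient of the 2-dimensional affine
domain `ℂ[S]`).  In `ℂ[X]/J` the class of `x_{j₀}` is transcendental over `ℂ` (its values along `M` are
unbounded) and, by transcendence degree, the class of `y_{j₀}` is algebraic over `ℂ[x_{j₀}]`: some
nonzero `H ∈ ℂ[s][t]` has `H(x_{j₀}, y_{j₀}) ∈ J`, i.e. `H(z, e^z) = 0` at `z = (p_m)_{x_{j₀}}`,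
`m ∈ M`.  By the logarithmic-strip lemma (`ZilberEacLogStrip`) these zeros have
`|Re z| = O(log ‖z‖)`, contradicting the escape.

Honest framing: a general sufficient condition for instances of an OPEN question; nothing about
`EC(3,2)` (OPEN) or Schanuel's conjecture is asserted; the density question in general stays open.
-/

noncomputable section

open MvPolynomial Filter
open Literature.NumberTheory.Transcendental Literature.ModelTheory.Zilber

set_option linter.dupNamespace false

namespace Summit.Schanuel.Schanuel.Theorems

/-! ## Algebra: a two-variable relation from transcendence degree `≤ 1` -/

section Algebra

universe u_1
variable {K : Type u_1} [CommRing K] [Algebra ℂ K]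

/-- If `v` is algebraic over `ℂ[u]` then some NONZERO `H ∈ ℂ[s][t]` has `H(u, v) = 0`. [folklore] -/
theorem exists_polyPoly_relation {u v : K} (hv : IsAlgebraic (Algebra.adjoin ℂ ({u} : Set K)) v) :
    ∃ H : Polynomial (Polynomial ℂ), H ≠ 0 ∧
      (Polynomial.eval₂RingHom (Polynomial.eval₂RingHom (algebraMap ℂ K) u) v) H = 0 := by
  set B := Algebra.adjoin ℂ ({u} : Set K) with hB
  have hBr : B = (Polynomial.aeval u).range := by rw [hB, Algebra.adjoin_singleton_eq_range_aeval]
  have hmem : ∀ q : Polynomial ℂ, Polynomial.aeval u q ∈ B := fun q => by rw [hBr]; exact ⟨q, rfl⟩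
  let φ : Polynomial ℂ →+* B :=
    (Polynomial.aeval u : Polynomial ℂ →ₐ[ℂ] K).toRingHom.codRestrict B.toSubring.toSubsemiring hmem
  have hφsurj : Function.Surjective φ := by
    rintro ⟨x, hx⟩
    rw [hBr] at hx
    obtain ⟨q, rfl⟩ := hx
    exact ⟨q, rfl⟩
  have hφ : (algebraMap B K).comp φ = Polynomial.eval₂RingHom (algebraMap ℂ K) u := by
    refine Polynomial.ringHom_ext (fun a => ?_) ?_
    · change (Polynomial.aeval u (Polynomial.C a) : K) = _
      rw [Polynomial.aeval_C, Polynomial.coe_eval₂RingHom, Polynomial.eval₂_C]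
    · change (Polynomial.aeval u (Polynomial.X : Polynomial ℂ) : K) = _
      rw [Polynomial.aeval_X, Polynomial.coe_eval₂RingHom, Polynomial.eval₂_X]
  obtain ⟨q, hq0, hqv⟩ := hv
  obtain ⟨P, hP⟩ := Polynomial.map_surjective φ hφsurj q
  refine ⟨P, fun h => hq0 (by rw [← hP, h, Polynomial.map_zero]), ?_⟩
  rw [Polynomial.coe_eval₂RingHom, ← hφ, ← Polynomial.eval₂_map, hP]
  exact hqv

/-- In a `ℂ`-algebra of transcendence degree `≤ 1` (with injective structure map), any `v` is
algebraic over `ℂ[u]` for a transcendental `u`. [folklore] -/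
theorem isAlgebraic_adjoin_of_trdeg_le_one [FaithfulSMul ℂ K] (h1 : Algebra.trdeg ℂ K ≤ 1)
    {u : K} (hu : Transcendental ℂ u) (v : K) :
    IsAlgebraic (Algebra.adjoin ℂ ({u} : Set K)) v := by
  by_contra hv
  have hind : AlgebraicIndependent ℂ (fun o : Option Unit => o.elim v fun _ : Unit => u) := by
    refine AlgebraicIndependent.option_iff.2 ⟨algebraicIndependent_unique_type_iff.2 hu, ?_⟩
    rwa [Set.range_const]
  have hle := hind.lift_cardinalMk_le_trdeg
  rw [Cardinal.mk_fintype, Fintype.card_option, Fintype.card_unit, Cardinal.lift_natCast] at hle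
  have h1' : Cardinal.lift.{0} (Algebra.trdeg ℂ K) ≤ 1 := by
    rw [← Cardinal.lift_one.{u_1, 0}]; exact Cardinal.lift_le.2 h1
  have := hle.trans h1'
  norm_cast at this

end Algebra

/-! ## The vanishing ideal of a generic subsequence -/

section Sequence

variable {n : ℕ}

/-- `x + 1 ≤ k + 1` in `WithBot ℕ∞` gives `x ≤ k`. [folklore] -/
theorem withBot_enat_le_of_add_one_le {x : WithBot ℕ∞} {k : ℕ}
    (h : x + 1 ≤ ((k + 1 : ℕ) : WithBot ℕ∞)) : x ≤ (k : ℕ) := by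
  induction x using WithBot.recBotCoe with
  | bot => exact bot_le
  | coe y =>
    induction y using ENat.recTopCoe with
    | top =>
      exfalso
      rw [← WithBot.coe_one, ← WithBot.coe_add, top_add, ← WithBot.coe_natCast, WithBot.coe_le_coe] at h
      exact not_le.2 (ENat.coe_lt_top (k + 1)) h
    | coe m =>
      have h1 : ((m : ℕ∞) : WithBot ℕ∞) + 1 = (((m + 1 : ℕ) : ℕ∞) : WithBot ℕ∞) := by norm_cast
      rw [h1, ← WithBot.coe_natCast, WithBot.coe_le_coe] at h
      have h3 : m + 1 ≤ k + 1 := by exact_mod_cast h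
      rw [← WithBot.coe_natCast, WithBot.coe_le_coe]
      exact_mod_cast (show m ≤ k by omega)

/-- **Noetherian step.**  If `f` vanishes at `p m` for infinitely many `m`, some infinite set `M` of
such indices has PRIME vanishing ideal `I({p m : m ∈ M})` (take it maximal among vanishing ideals of
infinite subsequences; maximality makes it stable under passing to infinite subsets). [folklore] -/
theorem exists_infinite_isPrime_vanishingIdeal {p : ℕ → Fin n ⊕ Fin n → ℂ}
    {f : MvPolynomial (Fin n ⊕ Fin n) ℂ} (hinf : Set.Infinite {m | aeval (p m) f = 0}) :
    ∃ M : Set ℕ, M.Infinite ∧ (∀ m ∈ M, aeval (p m) f = 0) ∧ (vanishingIdeal ℂ (p '' M)).IsPrime := by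
  classical
  set M₀ := {m | aeval (p m) f = 0} with hM₀
  set 𝓐 : Set (Ideal (MvPolynomial (Fin n ⊕ Fin n) ℂ)) :=
    {J | ∃ M : Set ℕ, M ⊆ M₀ ∧ M.Infinite ∧ J = vanishingIdeal ℂ (p '' M)} with h𝓐
  obtain ⟨J, ⟨M, hMM₀, hMinf, rfl⟩, hmax⟩ :=
    set_has_maximal_iff_noetherian.2 (inferInstance : IsNoetherian _ _) 𝓐 ⟨_, M₀, subset_rfl, hinf, rfl⟩
  have hmemI : ∀ (M' : Set ℕ) (g : MvPolynomial (Fin n ⊕ Fin n) ℂ),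
      g ∈ vanishingIdeal ℂ (p '' M') ↔ ∀ m ∈ M', aeval (p m) g = 0 := by
    intro M' g
    rw [mem_vanishingIdeal_iff]
    constructor
    · intro h m hm; exact h _ ⟨m, hm, rfl⟩
    · rintro h _ ⟨m, hm, rfl⟩; exact h m hm
  have stab : ∀ M' : Set ℕ, M' ⊆ M → M'.Infinite →
      vanishingIdeal ℂ (p '' M') = vanishingIdeal ℂ (p '' M) := by
    intro M' h h'
    have hle : vanishingIdeal ℂ (p '' M) ≤ vanishingIdeal ℂ (p '' M') :=
      vanishingIdeal_anti_mono (Set.image_mono h)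
    by_contra hne
    exact hmax _ ⟨M', h.trans hMM₀, h', rfl⟩ (lt_of_le_of_ne hle (Ne.symm hne))
  refine ⟨M, hMinf, fun m hm => hMM₀ hm, ?_, fun {a b} hab => ?_⟩
  · intro htop
    obtain ⟨m, hm⟩ := hMinf.nonempty
    have h1 : (1 : MvPolynomial (Fin n ⊕ Fin n) ℂ) ∈ vanishingIdeal ℂ (p '' M) := by
      rw [htop]; exact Submodule.mem_top
    have := (hmemI M 1).1 h1 m hm
    rw [map_one] at this
    exact one_ne_zero this
  · set Ma := {m ∈ M | aeval (p m) a = 0} with hMa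
    set Mb := {m ∈ M | aeval (p m) b = 0} with hMb
    have hcover : M ⊆ Ma ∪ Mb := by
      intro m hm
      have := (hmemI M _).1 hab m hm
      rw [map_mul, mul_eq_zero] at this
      rcases this with h | h
      · exact Or.inl ⟨hm, h⟩
      · exact Or.inr ⟨hm, h⟩
    rcases Set.infinite_union.1 (hMinf.mono hcover) with h | h
    · left
      rw [← stab Ma (fun m hm => hm.1) h, hmemI]
      exact fun m hm => hm.2
    · right
      rw [← stab Mb (fun m hm => hm.1) h, hmemI]
      exact fun m hm => hm.2

/-- **Dimension step.**  A prime `J ⊋ I(S)` (witnessed by `f ∈ J ∖ I(S)`) over an irreducible closed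
`S` of dimension `≤ 2` has `dim ℂ[X]/J ≤ 1`. [folklore] -/
theorem ringKrullDim_quotient_le_one {S : Set (Fin n ⊕ Fin n → ℂ)} (hS : IsIrreducibleClosed ℂ S)
    (hdim : zariskiDim ℂ S ≤ (2 : ℕ)) {J : Ideal (MvPolynomial (Fin n ⊕ Fin n) ℂ)} [J.IsPrime]
    (hIJ : vanishingIdeal ℂ S ≤ J) {f : MvPolynomial (Fin n ⊕ Fin n) ℂ} (hfJ : f ∈ J)
    (hf : f ∉ vanishingIdeal ℂ S) :
    ringKrullDim (MvPolynomial (Fin n ⊕ Fin n) ℂ ⧸ J) ≤ (1 : ℕ) := by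
  haveI : (vanishingIdeal ℂ S).IsPrime := hS.2
  haveI : IsDomain (MvPolynomial (Fin n ⊕ Fin n) ℂ ⧸ vanishingIdeal ℂ S) := Ideal.Quotient.isDomain _
  have h𝔭ne : J.map (Ideal.Quotient.mk (vanishingIdeal ℂ S)) ≠ ⊥ := by
    intro h
    have : Ideal.Quotient.mk (vanishingIdeal ℂ S) f ∈ J.map (Ideal.Quotient.mk (vanishingIdeal ℂ S)) :=
      Ideal.mem_map_of_mem _ hfJ
    rw [h, Ideal.mem_bot, Ideal.Quotient.eq_zero_iff_mem] at this
    exact hf this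
  have h1 := Literature.RingTheory.KrullDimension.ringKrullDim_quotient_add_one_le h𝔭ne
  rw [ringKrullDim_eq_of_ringEquiv (DoubleQuot.quotQuotEquivQuotOfLE hIJ)] at h1
  have h3 : ringKrullDim (MvPolynomial (Fin n ⊕ Fin n) ℂ ⧸ vanishingIdeal ℂ S) ≤ (2 : ℕ) := hdim
  exact withBot_enat_le_of_add_one_le (k := 1) (h1.trans h3)

/-- **Transcendence step.**  If the values `(p m)_{x_{j₀}}`, `m ∈ M`, are unbounded then the class of
`x_{j₀}` modulo `I({p m : m ∈ M})` is transcendental over `ℂ`. [folklore] -/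
theorem transcendental_mk_X_of_unbounded {p : ℕ → Fin n ⊕ Fin n → ℂ} {M : Set ℕ} (j₀ : Fin n)
    (hxM : ∀ R : ℝ, ∃ m ∈ M, R ≤ ‖p m (Sum.inl j₀)‖) :
    Transcendental ℂ (Ideal.Quotient.mk (vanishingIdeal ℂ (p '' M))
      (X (Sum.inl j₀) : MvPolynomial (Fin n ⊕ Fin n) ℂ)) := by
  rw [transcendental_iff]
  intro r hr
  by_contra hr0
  have hroots : ∀ m ∈ M, r.IsRoot (p m (Sum.inl j₀)) := by
    intro m hm
    have h1 : Polynomial.aeval (X (Sum.inl j₀) : MvPolynomial (Fin n ⊕ Fin n) ℂ) r ∈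
        vanishingIdeal ℂ (p '' M) := by
      rw [← Ideal.Quotient.eq_zero_iff_mem, ← Ideal.Quotient.mkₐ_eq_mk ℂ, ← Polynomial.aeval_algHom_apply]
      exact hr
    have h2 := (mem_vanishingIdeal_iff.1 h1) _ ⟨m, hm, rfl⟩
    rw [← Polynomial.aeval_algHom_apply, MvPolynomial.aeval_X, Polynomial.coe_aeval_eq_eval] at h2
    exact h2
  have hfin : ((fun m => p m (Sum.inl j₀)) '' M).Finite := by
    refine (r.roots.toFinset.finite_toSet).subset ?_
    rintro _ ⟨m, hm, rfl⟩
    rw [Finset.mem_coe, Multiset.mem_toFinset, Polynomial.mem_roots hr0]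
    exact hroots m hm
  obtain ⟨R, hR⟩ := (hfin.image fun w => ‖w‖).bddAbove
  obtain ⟨m, hm, hRm⟩ := hxM (R + 1)
  have := hR ⟨p m (Sum.inl j₀), ⟨m, hm, rfl⟩, rfl⟩
  linarith

/-- **Evaluation step.**  A relation `H(u, v) = 0` between the classes of `x_{j₀}, y_{j₀}` modulo
`I({p m : m ∈ M})` specialises to `H(x, y) = 0` at every `p m`, `m ∈ M`. [folklore] -/
theorem polyPoly_eval_eq_zero_of_mem {p : ℕ → Fin n ⊕ Fin n → ℂ} {M : Set ℕ} (j₀ : Fin n)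
    {H : Polynomial (Polynomial ℂ)}
    (hH : (Polynomial.eval₂RingHom (Polynomial.eval₂RingHom
        (algebraMap ℂ (MvPolynomial (Fin n ⊕ Fin n) ℂ ⧸ vanishingIdeal ℂ (p '' M)))
        (Ideal.Quotient.mk _ (X (Sum.inl j₀)))) (Ideal.Quotient.mk _ (X (Sum.inr j₀)))) H = 0)
    {m : ℕ} (hm : m ∈ M) :
    (H.map (Polynomial.evalRingHom (p m (Sum.inl j₀)))).eval (p m (Sum.inr j₀)) = 0 := by
  set J := vanishingIdeal ℂ (p '' M) with hJ
  have hkill : ∀ a ∈ J, aeval (p m) a = 0 := fun a ha => (mem_vanishingIdeal_iff.1 ha) _ ⟨m, hm, rfl⟩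
  let ψ : (MvPolynomial (Fin n ⊕ Fin n) ℂ ⧸ J) →ₐ[ℂ] ℂ := Ideal.Quotient.liftₐ J (aeval (p m)) hkill
  have hψX : ∀ j, ψ (Ideal.Quotient.mk J (X j)) = p m j := fun j => by
    change Ideal.Quotient.liftₐ J (aeval (p m)) hkill (Ideal.Quotient.mk J (X j)) = p m j
    rw [Ideal.Quotient.liftₐ_apply, Ideal.Quotient.lift_mk, RingHom.coe_coe, MvPolynomial.aeval_X]
  have h := congrArg ψ hH
  rw [map_zero, Polynomial.coe_eval₂RingHom, ← AlgHom.coe_toRingHom, Polynomial.hom_eval₂,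
    AlgHom.coe_toRingHom, hψX] at h
  have hcomp : (ψ : _ →+* ℂ).comp (Polynomial.eval₂RingHom (algebraMap ℂ _)
      (Ideal.Quotient.mk J (X (Sum.inl j₀)))) = Polynomial.evalRingHom (p m (Sum.inl j₀)) := by
    refine Polynomial.ringHom_ext (fun a => ?_) ?_
    · rw [RingHom.comp_apply, Polynomial.coe_eval₂RingHom, Polynomial.eval₂_C, RingHom.coe_coe,
        AlgHom.commutes, Polynomial.coe_evalRingHom, Polynomial.eval_C, Algebra.algebraMap_self, RingHom.id_apply]
    · rw [RingHom.comp_apply, Polynomial.coe_eval₂RingHom, Polynomial.eval₂_X, RingHom.coe_coe, hψX,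
        Polynomial.coe_evalRingHom, Polynomial.eval_X]
  rw [hcomp, ← Polynomial.eval_map] at h
  exact h

/-- **Theorem G (density from growth).**  On an irreducible closed `S` of dimension `≤ 2`, a sequence
of points of `S` whose `j₀`-th coordinate pair is exponential and escapes
(`|Re x_{j₀}| / log(2 + ‖x_{j₀}‖) → ∞`) is Zariski generic: every `f ∉ I(S)` vanishes at only
finitely many of its terms. [folklore] -/
theorem finite_zeros_of_growth {S : Set (Fin n ⊕ Fin n → ℂ)} (hS : IsIrreducibleClosed ℂ S)
    (hdim : zariskiDim ℂ S ≤ (2 : ℕ)) (j₀ : Fin n) {p : ℕ → Fin n ⊕ Fin n → ℂ}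
    (hpS : ∀ m, p m ∈ S) (hexp : ∀ m, p m (Sum.inr j₀) = Complex.exp (p m (Sum.inl j₀)))
    (hgr : Tendsto (fun m => |(p m (Sum.inl j₀)).re| / Real.log (2 + ‖p m (Sum.inl j₀)‖)) atTop atTop)
    (f : MvPolynomial (Fin n ⊕ Fin n) ℂ) (hf : f ∉ vanishingIdeal ℂ S) :
    Set.Finite {m | aeval (p m) f = 0} := by
  classical
  by_contra hinf
  change Set.Infinite {m | aeval (p m) f = 0} at hinf
  -- the escaping coordinate goes to infinity
  set x : ℕ → ℂ := fun m => p m (Sum.inl j₀) with hxdef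
  have hlog2 : 0 < Real.log 2 := Real.log_pos one_lt_two
  have hnorm : Tendsto (fun m => ‖x m‖) atTop atTop := by
    have hle : ∀ m, |(x m).re| / Real.log (2 + ‖x m‖) * Real.log 2 ≤ ‖x m‖ := by
      intro m
      have hl : Real.log 2 ≤ Real.log (2 + ‖x m‖) :=
        Real.log_le_log two_pos (by linarith [norm_nonneg (x m)])
      have hlpos : 0 < Real.log (2 + ‖x m‖) := hlog2.trans_le hl
      calc |(x m).re| / Real.log (2 + ‖x m‖) * Real.log 2
          ≤ |(x m).re| / Real.log (2 + ‖x m‖) * Real.log (2 + ‖x m‖) :=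
            mul_le_mul_of_nonneg_left hl (div_nonneg (abs_nonneg _) hlpos.le)
        _ = |(x m).re| := div_mul_cancel₀ _ hlpos.ne'
        _ ≤ ‖x m‖ := Complex.abs_re_le_norm _
    exact tendsto_atTop_mono hle (hgr.atTop_mul_const hlog2)
  -- a prime vanishing ideal of an infinite subsequence of zeros of `f`
  obtain ⟨M, hMinf, hMf, hJ⟩ := exists_infinite_isPrime_vanishingIdeal hinf
  set J := vanishingIdeal ℂ (p '' M) with hJdef
  haveI := hJ
  have hIJ : vanishingIdeal ℂ S ≤ J :=
    vanishingIdeal_anti_mono (by rintro _ ⟨m, -, rfl⟩; exact hpS m)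
  have hfJ : f ∈ J := by
    rw [hJdef, mem_vanishingIdeal_iff]
    rintro _ ⟨m, hm, rfl⟩
    exact hMf m hm
  -- `dim ℂ[X]/J ≤ 1`, hence `trdeg ≤ 1`
  have hdimJ := ringKrullDim_quotient_le_one hS hdim hIJ hfJ hf
  set Q' := MvPolynomial (Fin n ⊕ Fin n) ℂ ⧸ J with hQ'
  haveI : IsDomain Q' := Ideal.Quotient.isDomain _
  have htr : Algebra.trdeg ℂ Q' ≤ 1 := by
    have h := Literature.RingTheory.KrullDimension.ringKrullDim_eq_trdeg ℂ Q'
    rw [h] at hdimJ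
    have hnat : Cardinal.toNat (Algebra.trdeg ℂ Q') ≤ 1 := by exact_mod_cast hdimJ
    rw [Literature.RingTheory.KrullDimension.trdeg_eq_toNat ℂ Q']
    exact_mod_cast hnat
  -- `x_{j₀}` transcendental, `y_{j₀}` algebraic over `ℂ[x_{j₀}]` modulo `J`
  have hxM : ∀ R : ℝ, ∃ m ∈ M, R ≤ ‖x m‖ := by
    intro R
    rcases (tendsto_atTop_atTop.1 hnorm R) with ⟨N', hN'⟩
    obtain ⟨m, hm, hNm⟩ := hMinf.exists_gt N'
    exact ⟨m, hm, hN' m hNm.le⟩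
  haveI : FaithfulSMul ℂ Q' := (faithfulSMul_iff_algebraMap_injective ℂ Q').2 (algebraMap ℂ Q').injective
  have hutr := transcendental_mk_X_of_unbounded (p := p) (M := M) j₀ hxM
  obtain ⟨H, hH0, hHuv⟩ := exists_polyPoly_relation
    (isAlgebraic_adjoin_of_trdeg_le_one htr hutr (Ideal.Quotient.mk J (X (Sum.inr j₀))))
  have hHroot : ∀ m ∈ M, (H.map (Polynomial.evalRingHom (x m))).eval (Complex.exp (x m)) = 0 := by
    intro m hm
    rw [← hexp m]
    exact polyPoly_eval_eq_zero_of_mem j₀ hHuv hm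
  -- pass to the subsequence indexed by `M` and apply the logarithmic strip
  set φ : ℕ → ℕ := Nat.nth (· ∈ M) with hφ
  have hφM : ∀ k, φ k ∈ M := fun k => Nat.nth_mem_of_infinite (p := (· ∈ M)) hMinf k
  have hφtop : Tendsto φ atTop atTop := (Nat.nth_strictMono (p := (· ∈ M)) hMinf).tendsto_atTop
  have hztop : Tendsto (fun k => ‖x (φ k)‖) atTop atTop := hnorm.comp hφtop
  obtain ⟨C, N, hCN⟩ := abs_re_le_log_of_polyExp_zero H hH0 hztop (fun k => hHroot _ (hφM k))
  have hgr' : Tendsto (fun k => |(x (φ k)).re| / Real.log (2 + ‖x (φ k)‖)) atTop atTop :=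
    hgr.comp hφtop
  -- but the strip bounds the escape ratio
  have hbd : ∀ᶠ k in atTop, |(x (φ k)).re| / Real.log (2 + ‖x (φ k)‖) ≤ |C| / Real.log 2 + N := by
    filter_upwards [hCN] with k hk
    have hl2 : Real.log 2 ≤ Real.log (2 + ‖x (φ k)‖) :=
      Real.log_le_log two_pos (by linarith [norm_nonneg (x (φ k))])
    have hlpos : 0 < Real.log (2 + ‖x (φ k)‖) := hlog2.trans_le hl2
    have hl1 : Real.log (1 + ‖x (φ k)‖) ≤ Real.log (2 + ‖x (φ k)‖) :=
      Real.log_le_log (by linarith [norm_nonneg (x (φ k))]) (by linarith)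
    have hl1nn : 0 ≤ Real.log (1 + ‖x (φ k)‖) := Real.log_nonneg (by linarith [norm_nonneg (x (φ k))])
    rw [div_le_iff₀ hlpos]
    have hC : C ≤ |C| := le_abs_self C
    have hN0 : (0 : ℝ) ≤ N := Nat.cast_nonneg N
    have hCl : |C| ≤ |C| / Real.log 2 * Real.log (2 + ‖x (φ k)‖) := by
      rw [div_mul_eq_mul_div, le_div_iff₀ hlog2]
      exact mul_le_mul_of_nonneg_left hl2 (abs_nonneg C)
    calc |(x (φ k)).re| ≤ C + N * Real.log (1 + ‖x (φ k)‖) := hk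
      _ ≤ |C| + N * Real.log (2 + ‖x (φ k)‖) := by nlinarith
      _ ≤ (|C| / Real.log 2 + N) * Real.log (2 + ‖x (φ k)‖) := by rw [add_mul]; linarith
  obtain ⟨k, hk1, hk2⟩ := (hbd.and (hgr'.eventually_gt_atTop (|C| / Real.log 2 + N))).exists
  exact absurd hk2 (not_lt.2 hk1)

/-- **Corollary (density from growth).**  If the escaping sequence consists of exponential points of
`S`, then `S` has Zariski-dense exponential points (`UnprojectedDense S`, seat 1's dictionary for
Mantova–Masser's question). [folklore] -/
theorem unprojectedDense_of_growth {S : Set (Fin n ⊕ Fin n → ℂ)} (hS : IsIrreducibleClosed ℂ S)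
    (hdim : zariskiDim ℂ S ≤ (2 : ℕ)) (j₀ : Fin n) {p : ℕ → Fin n ⊕ Fin n → ℂ}
    (hpS : ∀ m, p m ∈ S) (hpΓ : ∀ m, p m ∈ expGraph ℂ n)
    (hgr : Tendsto (fun m => |(p m (Sum.inl j₀)).re| / Real.log (2 + ‖p m (Sum.inl j₀)‖)) atTop atTop) :
    UnprojectedDense S := by
  refine le_antisymm ?_ (vanishingIdeal_anti_mono Set.inter_subset_left)
  intro f hf
  by_contra hfS
  have hexp : ∀ m, p m (Sum.inr j₀) = Complex.exp (p m (Sum.inl j₀)) := fun m => by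
    have := (mem_expGraph_iff.1 (hpΓ m)) j₀
    rw [this, Literature.ModelTheory.ExponentialFields.ExponentialRing.complex_exp_eq]
  have hfin := finite_zeros_of_growth hS hdim j₀ hpS hexp hgr f hfS
  have hall : {m | aeval (p m) f = 0} = Set.univ := by
    ext m
    simp only [Set.mem_setOf_eq, Set.mem_univ, iff_true]
    exact (mem_vanishingIdeal_iff.1 hf) _ ⟨hpS m, hpΓ m⟩
  rw [hall] at hfin
  exact Set.infinite_univ hfin

end Sequence

end Summit.Schanuel.Schanuel.Theorems
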